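import Literature.NumberTheory.GaloisCohomology.CyclicClassLocalArtinSymbolLocal
import Literature.NumberTheory.GaloisRepresentations.CyclotomicCharacterArtinNormProofs
import Literature.NumberTheory.GaloisRepresentations.LocalKroneckerWeberInertiaProofs
import HarnessLib

/-!
# The local invariant of a cyclic class is the local Artin symbol, IV: any decomposition behaviour
# (Serre, *Corps locaux* XIV §1 Prop. 3 at a completion, for the restricted character `ψ ∘ res_v` itself)

Part III (`CyclicClassLocalArtinSymbolLocal.lean`, `invLevel_cupProduct_δ₀_scalarCocycle_eq_neg_apply_of_restrict`)
evaluates THE residue map of `K_v` on `κₙ(x) ∪ [θ·id]` for a cyclic character `θ : Γ_{K_v} ↠ ℤ/n` that is the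
restriction of a global `ψ : Γ_K ↠ ℤ/n`; the tree's `CyclicCharacter` is SURJECTIVE, so that form only covers
the places `v` whose decomposition group surjects onto `Gal(L/K)` (`L` the field cut out by `ψ`).  Here the
same identity is proved for the restricted character `ψ ∘ res_v` ITSELF, of any image, read as ANY continuous
crossed homomorphism `c : Γ_{K_v} → μₙ^∨(1)` with `c(σ) = ψ(res_v σ)·id`:

* `resMu_cupProduct_δ₀_scalarCocycle_eq_of_forall_apply` — `Res_{E/F}(κₙ(x) ∪ [ψ·id]) = κₙ(x_E) ∪ [c]` for
  fields `E/F`, `ψ : Γ_F ↠ ℤ/n` and any cocycle `c` on `Γ_E` with `c(σ)(m) = ψ(res σ)·m` (the degree-`(1,1)`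
  naturality of `Prop121vii.resMu_cupProduct_δ₀_scalarCocycle`, freed of the surjective `ψ_E` and of `f`);
* ★ `invLevel_cupProduct_δ₀_eq_neg_apply_of_forall_apply` — for a number field `K`, a finite place `v`,
  `ψ : Γ_K ↠ ℤ/n` global cyclic (`ker ψ = Gal(K̄/L)`), ANY such `c` on `Γ_{K_v}`, every local `x ∈ K_vˣ` and
  `w ∈ W_{K_v}` with `Art_v w = x`:  **`inv_n (κₙ(x) ∪ [c]) = -ψ(res_v w)`** — no hypothesis on the
  decomposition group (density argument of part III verbatim, with part II for global `b`);
* `cupProduct_δ₀_eq_zero_iff_of_forall_apply` — `κₙ(x) ∪ [c] = 0 ↔ ψ(res_v w) = 0`;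
* `invLevel_cupProduct_δ₀_eq_neg_apply_of_cyclotomicCharacter_eq_norm_of_forall_apply` — Kato II Lemma 1.4.5
  levelwise at `v ∣ p` for such `c`: `ψ` factoring through `ε_p`, `u ∈ 𝒪_vˣ`, `ε_p(σ) = N_{K_v/ℚ_p}(u)` ⟹
  `inv_n (κₙ(u) ∪ [c]) = -ψ(σ)` (the companion `CyclicClassLocalArtinSymbolCyclotomic.lean` does this for surjective `θ`).

Proof file: theorems only (no definition, no named fact, no instance; D-0026).  HONEST FRAMING: textbook local
class field theory at completions of number fields; floor (d) (levelwise, completions, all places) of the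
[REC] programme of crux K★ `stmt-BirchSwinnertonDyer-22226` (line `kato_lever`); no case of BSD is proved.

## References

* J.-P. Serre, *Local Fields* (1979), XIV §1 Prop. 3. [SerreLocalFields1979]
* J. Neukirch, A. Schmidt, K. Wingberg, *Cohomology of Number Fields* (2008), I §4–§5 (cup products and
  compatible pairs on inhomogeneous cochains). [NeukirchSchmidtWingberg2008]
* J. Neukirch, *Algebraic Number Theory* (1999), VI (5.6)–(5.8). [NeukirchANT1999]
-/

noncomputable section

open CategoryTheory Function NumberField IsDedekindDomain Field ValuativeRel
open scoped NumberField

namespace Literature.NumberTheory.GaloisCohomology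

open _root_.ContinuousCohomology
open Literature.NumberTheory.GaloisRepresentations
open Literature.NumberTheory.GaloisRepresentations.DiscreteGaloisModule
open Literature.NumberTheory.GaloisRepresentations.LocalWeilDatum
open Literature.NumberTheory.GaloisRepresentations.IsNonarchimedeanLocalField
open Literature.NumberTheory.NumberFields
open Literature.AnabelianGeometry.AbsoluteAnabelian
open Literature.AnabelianGeometry.AbsoluteAnabelian.Prop121vii

universe u

/-! ### §1. `Res (κₙ(x) ∪ [ψ·id]) = κₙ(x_E) ∪ [c]` for any cocycle `c` representing `ψ ∘ res` -/

section Restriction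

variable (F E : Type u) [Field F] [Field E] [Algebra F E] {n : ℕ} [NeZero n]

/-- `unitsVal (u - v) = unitsVal u / unitsVal v`. [folklore] -/
private theorem unitsVal_sub'' (K : Type u) [Field K] (u v : UnitsCarrier K) :
    unitsVal K (u - v) = unitsVal K u / unitsVal K v := rfl

/-- `ι (algebraMap F F̄ x) = algebraMap E Ē (algebraMap F E x)`. [folklore] -/
private theorem absClosureEmbedding_algebraMap'' (x : F) :
    absClosureEmbedding F E (algebraMap F (AlgebraicClosure F) x) =
      algebraMap E (AlgebraicClosure E) (algebraMap F E x) := by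
  rw [(absClosureEmbedding F E).commutes x, IsScalarTower.algebraMap_apply F E (AlgebraicClosure E)]

/-- **Restriction of the cyclic class to a subgroup of any image.**  For fields `E/F`, a cyclic character
`ψ : Γ_F ↠ ℤ/n`, `x ∈ Fˣ`, and ANY continuous crossed homomorphism `c : Γ_E → μₙ^∨(1)` with
`c(σ)(m) = ψ(res σ)·m` (the restricted character `ψ ∘ res`, surjective or not, read as a cocycle):
`Res_{E/F}(κₙ(x) ∪ [ψ·id]) = κₙ(x_E) ∪ [c]` in `H²(Γ_E, μₙ(Ē))` — naturality of the Kummer connecting map and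
of the cup product under the compatible pair `(res, ι|μₙ)` on inhomogeneous cocycles (the computation of
`Prop121vii.resMu_cupProduct_δ₀_scalarCocycle`, without the factorisation `ψ ∘ res = f·ψ_E`).
[cite: NeukirchSchmidtWingberg2008, I §4 (1.4.2), §5] -/
theorem resMu_cupProduct_δ₀_scalarCocycle_eq_of_forall_apply (ψ : CyclicCharacter (absoluteGaloisGroup F) n)
    (c : contOneCocycles ((mu E n).tateDual n).toTopRep)
    (hc : ∀ (σ : absoluteGaloisGroup E) (m : MuCarrier E n),
      c.1 σ m = (((ψ (absGaloisRestrict F E σ)).val : ℤ)) • m)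
    (x : F) (hx : x ≠ 0) (hx' : algebraMap F E x ≠ 0) :
    haveI : CompactSpace (absoluteGaloisGroup F) := absoluteGaloisGroup_compactSpace F
    haveI : CompactSpace (absoluteGaloisGroup E) := absoluteGaloisGroup_compactSpace E
    resMu F E n 2 (((mu F n).tateDualPairing n).cupProduct
        ((isSES_kummer F n (NeZero.pos n)).δ₀ (baseUnitsInvariant F x hx)) (oneCocycleClass _ (scalarCocycle ψ))) =
      ((mu E n).tateDualPairing n).cupProduct
        ((isSES_kummer E n (NeZero.pos n)).δ₀ (baseUnitsInvariant E (algebraMap F E x) hx'))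
        (oneCocycleClass _ c) := by
  haveI : CompactSpace (absoluteGaloisGroup F) := absoluteGaloisGroup_compactSpace F
  haveI : CompactSpace (absoluteGaloisGroup E) := absoluteGaloisGroup_compactSpace E
  have hn : 0 < n := NeZero.pos n
  have hF := isSES_kummer F n hn
  have hE := isSES_kummer E n hn
  set uF := baseUnitsInvariant F x hx with huF
  set uE := baseUnitsInvariant E (algebraMap F E x) hx' with huE
  -- an `n`-th root `w` of `x` in `F̄ˣ`, and its image `w'` in `Ēˣ`
  obtain ⟨w, hw⟩ := hF.surjective (uF : UnitsCarrier F)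
  have hwn : unitsVal F w ^ n = unitsVal F (uF : UnitsCarrier F) := by
    have e := congrArg (unitsVal F) hw
    rwa [kummerπ_hom_apply, unitsVal_zsmul, zpow_natCast] at e
  let ι : (AlgebraicClosure F)ˣ →* (AlgebraicClosure E)ˣ :=
    Units.map (absClosureEmbedding F E).toRingHom.toMonoidHom
  have hι : ∀ y : (AlgebraicClosure F)ˣ, ((ι y : (AlgebraicClosure E)ˣ) : AlgebraicClosure E) =
      absClosureEmbedding F E (y : AlgebraicClosure F) := fun y => rfl
  let w' : UnitsCarrier E := UnitsCarrier.ofUnits (ι (unitsVal F w))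
  have hw' : (kummerπ E n).hom w' = (uE : UnitsCarrier E) := by
    apply unitsVal_injective E
    rw [kummerπ_hom_apply, unitsVal_zsmul, zpow_natCast]
    change ι (unitsVal F w) ^ n = unitsVal E (uE : UnitsCarrier E)
    rw [← map_pow, hwn]
    refine Units.ext ?_
    rw [hι, huF, coe_unitsVal_baseUnitsInvariant, huE, coe_unitsVal_baseUnitsInvariant,
      absClosureEmbedding_algebraMap'']
  have hwinv : (kummerπ F n).hom w ∈ (units F).toTopRep.ρ.invariants := by rw [hw]; exact uF.2
  have hw'inv : (kummerπ E n).hom w' ∈ (units E).toTopRep.ρ.invariants := by rw [hw']; exact uE.2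
  -- the Kummer cocycles correspond under `(res, ι)`
  have hδ : ∀ σ : absoluteGaloisGroup E,
      muRes F E n ((hF.δ₀Cocycle w hwinv).1 (absGaloisRestrict F E σ)) = (hE.δ₀Cocycle w' hw'inv).1 σ := by
    intro σ
    apply hE.injective
    apply unitsVal_injective E
    rw [hE.f_δ₀Cocycle_apply, unitsVal_kummerι, muVal_muRes, ← unitsVal_kummerι, hF.f_δ₀Cocycle_apply,
      unitsVal_sub'', unitsVal_sub'', map_div, unitsVal_apply, unitsVal_apply]
    congr 1
    refine Units.ext ?_
    change absClosureEmbedding F E (((absGaloisRestrict F E σ • unitsVal F w : (AlgebraicClosure F)ˣ) :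
      AlgebraicClosure F)) = ((σ • ι (unitsVal F w) : (AlgebraicClosure E)ˣ) : AlgebraicClosure E)
    rw [Units.coe_smul, Units.coe_smul, absGaloisRestrict_apply_smul]
    rfl
  -- both sides on explicit cocycles
  rw [hF.δ₀_apply_eq uF w hw, hE.δ₀_apply_eq uE w' hw',
    ContPairing.cupProduct_oneCocycleClass_eq_twoCocycleClass,
    ContPairing.cupProduct_oneCocycleClass_eq_twoCocycleClass, resMu_apply, map_twoCocycleClass]
  refine congrArg (twoCocycleClass _) (Subtype.ext (ContinuousMap.ext fun q => ?_))
  obtain ⟨σ, τ⟩ := q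
  have hsubE : ∀ (h h' : TateDual E (MuCarrier E n) n) (m : MuCarrier E n), (h - h') m = h m - h' m :=
    fun _ _ _ => rfl
  rw [contTwoCocycles.pullback_apply, ContPairing.cupCocycle_apply, ContPairing.cupCocycle_apply,
    resCoeff_hom_apply]
  change muRes F E n
      ((((ψ (absGaloisRestrict F E σ * absGaloisRestrict F E τ)).val : ℤ) •
          ((hF.δ₀Cocycle w hwinv).1 (absGaloisRestrict F E σ) : MuCarrier F n)) -
        (((ψ (absGaloisRestrict F E σ)).val : ℤ) •
          ((hF.δ₀Cocycle w hwinv).1 (absGaloisRestrict F E σ) : MuCarrier F n))) =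
    (c.1 (σ * τ) - c.1 σ) ((hE.δ₀Cocycle w' hw'inv).1 σ : MuCarrier E n)
  rw [hsubE, hc, hc, ← map_mul, map_sub, map_zsmul, map_zsmul, hδ]
  rfl

end Restriction

/-! ### §2. `inv_n (κₙ(x) ∪ [ψ ∘ res_v]) = -ψ(res_v w)` for every local `x`, any decomposition group -/

section LocalB

variable {K : Type} [Field K] [NumberField K] {n : ℕ} [NeZero n]
  (L : IntermediateField K (AlgebraicClosure K)) [FiniteDimensional K L] [IsAbelianGalois K L]
  [NumberField L] (v : HeightOneSpectrum (𝓞 K))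

/-- `baseUnitsInvariant` only depends on the element (proof-irrelevance helper). [folklore] -/
private theorem baseUnitsInvariant_congr''' {E : Type} [Field E] {x y : E} (hx : x ≠ 0) (hy : y ≠ 0)
    (h : x = y) : baseUnitsInvariant E x hx = baseUnitsInvariant E y hy := by
  subst h; rfl

/-- **Serre XIV §1 Prop. 3 at a completion, for the restricted character itself.**  `K` a number field, `v`
a finite place, `ψ : Γ_K ↠ ℤ/n` a global cyclic character with `ker ψ = Gal(K̄/L)`, `c : Γ_{K_v} → μₙ^∨(1)` ANY
continuous crossed homomorphism with `c(σ)(m) = ψ(res_v σ)·m` (the class `[ψ ∘ res_v · id] ∈ H¹(Γ_{K_v}, μₙ^∨(1))`,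
whatever the decomposition group), `x ∈ K_v`, `x ≠ 0`, `w ∈ W_{K_v}` with `Art_v w = x`.  Then

  `inv_n (κₙ(x) ∪ [c]) = -ψ(res_v w)`.

Density of `K` in `K_v`: both sides are characters of `K_vˣ` trivial on the open `N_{K_vL/K_v} ∩ (K_vˣ)ⁿ` and
agree on `Kˣ` by part II (`localInvariantMap_localization_cupProduct_δ₀_eq_neg_apply`) and §1.
[cite: SerreLocalFields1979, XIV §1 Prop. 3] [cite: NeukirchANT1999, Ch. VI §5 (5.6)–(5.8)] -/
theorem invLevel_cupProduct_δ₀_eq_neg_apply_of_forall_apply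
    (ψ : CyclicCharacter (absoluteGaloisGroup K) n) (hker : ψ.ker = galFixing K L)
    (c : contOneCocycles ((mu (v.adicCompletion K) n).tateDual n).toTopRep)
    (hc : ∀ (σ : absoluteGaloisGroup (v.adicCompletion K)) (m : MuCarrier (v.adicCompletion K) n),
      c.1 σ m = (((ψ (absGaloisRestrict K (v.adicCompletion K) σ)).val : ℤ)) • m)
    (x : v.adicCompletion K) (hx : x ≠ 0) (w : WeilGroup (v.adicCompletion K))
    (hw : ((canonicalArtin (v.adicCompletion K) w : (v.adicCompletion K)ˣ) : v.adicCompletion K) = x) :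
    haveI : CompactSpace (absoluteGaloisGroup (v.adicCompletion K)) := absoluteGaloisGroup_compactSpace _
    haveI : CharZero (v.adicCompletion K) := charZero_adicCompletion v
    invLevel (v.adicCompletion K) n (((mu (v.adicCompletion K) n).tateDualPairing n).cupProduct
        ((isSES_kummer (v.adicCompletion K) n (NeZero.pos n)).δ₀ (baseUnitsInvariant (v.adicCompletion K) x hx))
        (oneCocycleClass _ c)) =
      -ψ (absGaloisRestrict K (v.adicCompletion K) (WeilGroup.toAbsGalois (v.adicCompletion K) w)) := by
  classical
  haveI : CompactSpace (absoluteGaloisGroup K) := absoluteGaloisGroup_compactSpace K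
  haveI : CompactSpace (absoluteGaloisGroup (v.adicCompletion K)) := absoluteGaloisGroup_compactSpace _
  haveI : CharZero (v.adicCompletion K) := charZero_adicCompletion v
  have ha := isLocalArtinMap_canonicalArtin_holds (v.adicCompletion K)
  obtain ⟨ψbar, hψbar_apply⟩ := exists_character_absRestrictNormalHom_eq L ψ hker
  -- carrier-typed aliases
  let ι : continuousCohomology 2 (mu (v.adicCompletion K) n).toTopRep →+ ZMod n := invLevel (v.adicCompletion K) n
  let P := (mu (v.adicCompletion K) n).tateDualPairing n
  let g := oneCocycleClass ((mu (v.adicCompletion K) n).tateDual n).toTopRep c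
  let δ := (isSES_kummer (v.adicCompletion K) n (NeZero.pos n)).δ₀
  -- the two sides as functions of `y ∈ K_vˣ`
  set I : (v.adicCompletion K)ˣ → ZMod n := fun y =>
    ι (P.cupProduct (δ (baseUnitsInvariant (v.adicCompletion K) (y : v.adicCompletion K) y.ne_zero)) g) with hI
  set R : (v.adicCompletion K)ˣ →* Multiplicative (ZMod n) :=
    ψbar.comp ((artinIdeleMap L artinReciprocity_character_holds).comp (localUnits v)) with hRdef
  have hRapply : ∀ y : (v.adicCompletion K)ˣ,
      R y = ψbar (artinIdeleMap L artinReciprocity_character_holds (localUnits v y)) := fun y => rfl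
  -- `R (Art_v w') = -ψ(res w')`
  have hR_art : ∀ w' : WeilGroup (v.adicCompletion K),
      Multiplicative.toAdd (R (canonicalArtin (v.adicCompletion K) w')) =
        -ψ (absGaloisRestrict K (v.adicCompletion K) (WeilGroup.toAbsGalois (v.adicCompletion K) w')) :=
    fun w' => by
    rw [hRapply, artinIdeleMap_localUnits_canonicalArtin_eq_inv L w', map_inv, hψbar_apply, toAdd_inv,
      toAdd_ofAdd]
  -- additivity of `I`
  have hadd : ∀ a b : continuousCohomology 1 (mu (v.adicCompletion K) n).toTopRep,
      P.cupProduct (a + b) g = P.cupProduct a g + P.cupProduct b g := fun a b => by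
    rw [map_add, LinearMap.add_apply]
  have hImul : ∀ y₁ y₂ : (v.adicCompletion K)ˣ, I (y₁ * y₂) = I y₁ + I y₂ := by
    intro y₁ y₂
    have hbase : baseUnitsInvariant (v.adicCompletion K) ((y₁ * y₂ : (v.adicCompletion K)ˣ) : v.adicCompletion K)
          (y₁ * y₂).ne_zero =
        baseUnitsInvariant (v.adicCompletion K) (y₁ : v.adicCompletion K) y₁.ne_zero +
          baseUnitsInvariant (v.adicCompletion K) (y₂ : v.adicCompletion K) y₂.ne_zero :=
      baseUnitsInvariant_mul (v.adicCompletion K) _ _ y₁.ne_zero y₂.ne_zero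
    simp only [hI]
    rw [hbase, map_add δ, hadd, map_add ι]
  -- the local norm group `N_v`; `R` kills it
  set Nv : Subgroup (v.adicCompletion K)ˣ := (Units.map (Algebra.norm (v.adicCompletion K) :
      (IntermediateField.adjoin (v.adicCompletion K)
        (Set.range ((absClosureEmbedding K (v.adicCompletion K)).comp L.val))) →* v.adicCompletion K)).range
    with hNv
  have hR_norm : ∀ y ∈ Nv, R y = 1 := fun y hy => by
    rw [hRapply, (artinIdeleMap_localUnits_eq_one_iff_mem_range_norm L y).mpr hy, map_one]
  -- `I` kills the `n`-th powers
  have hI_pow : ∀ u : (v.adicCompletion K)ˣ,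
      u ∈ (powMonoidHom n : (v.adicCompletion K)ˣ →* (v.adicCompletion K)ˣ).range → I u = 0 := by
    rintro u ⟨t, rfl⟩
    simp only [hI]
    rw [baseUnitsInvariant_congr''' (powMonoidHom n t).ne_zero (pow_ne_zero n t.ne_zero)
      (by rw [powMonoidHom_apply, Units.val_pow_eq_pow_val]),
      δ₀_baseUnitsInvariant_pow_eq_zero (v.adicCompletion K) (t : v.adicCompletion K) t.ne_zero,
      map_zero P.cupProduct, LinearMap.zero_apply, map_zero ι]
  -- part II for global `b`, in the local currency via §1: `I b = R b`
  have hglob : ∀ b : Kˣ, I (globalToLocalUnits v b) =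
      Multiplicative.toAdd (R (globalToLocalUnits v b)) := by
    intro b
    obtain ⟨w₁, hw₁⟩ := ha.isOpenQuotientMap_artin.surjective (globalToLocalUnits v b)
    have hb : algebraMap K (v.adicCompletion K) (b : K) ≠ 0 :=
      (map_ne_zero_iff _ (algebraMap K (v.adicCompletion K)).injective).2 b.ne_zero
    have h := localInvariantMap_localization_cupProduct_δ₀_eq_neg_apply L ψ hker b v w₁ hw₁
    rw [localInvariantMap_localization] at h
    have hres := resMu_cupProduct_δ₀_scalarCocycle_eq_of_forall_apply K (v.adicCompletion K) ψ c hc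
      (b : K) b.ne_zero hb
    change invLevel (v.adicCompletion K) n (resMu K (v.adicCompletion K) n 2 _) = _ at h
    rw [hres] at h
    have h' : ι (P.cupProduct (δ (baseUnitsInvariant (v.adicCompletion K)
        (algebraMap K (v.adicCompletion K) (b : K)) hb)) g) =
        -ψ (absGaloisRestrict K (v.adicCompletion K) (WeilGroup.toAbsGalois (v.adicCompletion K) w₁)) := h
    simp only [hI]
    rw [baseUnitsInvariant_congr''' (globalToLocalUnits v b).ne_zero hb (val_globalToLocalUnits v b), h',
      ← hR_art w₁, hw₁]
  -- the open subgroup `U = N_v ∩ (K_vˣ)^n`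
  set U : Subgroup (v.adicCompletion K)ˣ :=
    Nv ⊓ (powMonoidHom n : (v.adicCompletion K)ˣ →* (v.adicCompletion K)ˣ).range with hU
  have hUopen : IsOpen (U : Set (v.adicCompletion K)ˣ) := by
    haveI : Nv.FiniteIndex := ⟨index_range_norm_ne_zero L⟩
    have h1 : IsOpen (Nv : Set (v.adicCompletion K)ˣ) :=
      Subgroup.isOpen_of_finiteIndex_units_localField (K := v.adicCompletion K) Nv
    have h2 : IsOpen (((powMonoidHom n : (v.adicCompletion K)ˣ →* (v.adicCompletion K)ˣ).range :
        Subgroup (v.adicCompletion K)ˣ) : Set (v.adicCompletion K)ˣ) :=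
      isOpen_range_powMonoidHom_units (v.adicCompletion K) (Nat.cast_ne_zero.mpr (NeZero.ne n))
    exact h1.inter h2
  -- `Units.val : K_vˣ → K_v` is an open embedding
  have hvalopen : IsOpenMap (Units.val : (v.adicCompletion K)ˣ → v.adicCompletion K) := by
    have hrange : Set.range (Units.val : (v.adicCompletion K)ˣ → v.adicCompletion K) = {0}ᶜ := by
      ext z
      simp only [Set.mem_range, Set.mem_compl_iff, Set.mem_singleton_iff]
      exact ⟨fun ⟨u, hu⟩ => hu ▸ u.ne_zero, fun hz => ⟨Units.mk0 z hz, rfl⟩⟩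
    exact (⟨Units.isEmbedding_val₀, by rw [hrange]; exact isOpen_compl_singleton⟩ :
      Topology.IsOpenEmbedding (Units.val : (v.adicCompletion K)ˣ → v.adicCompletion K)).isOpenMap
  -- density of `K` in `K_v`: `x = b · u` with `b ∈ Kˣ`, `u ∈ U`
  set y : (v.adicCompletion K)ˣ := Units.mk0 x hx with hy
  set C : Set (v.adicCompletion K)ˣ := (fun z => y⁻¹ * z) ⁻¹' (U : Set (v.adicCompletion K)ˣ) with hCdef
  have hCopen : IsOpen C := hUopen.preimage (continuous_const_mul _)
  have hyC : y ∈ C := by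
    change y⁻¹ * y ∈ (U : Set (v.adicCompletion K)ˣ)
    rw [inv_mul_cancel]
    exact U.one_mem
  obtain ⟨k, z', hz'C, hz'k⟩ :=
    (HeightOneSpectrum.denseRange_algebraMap (K := K) (v := v)).exists_mem_open (hvalopen _ hCopen)
      ⟨(y : v.adicCompletion K), y, hyC, rfl⟩
  have hk0 : k ≠ 0 := by
    intro h
    exact z'.ne_zero (by rw [hz'k, h, map_zero])
  set b : Kˣ := Units.mk0 k hk0 with hb
  have hbz : globalToLocalUnits v b = z' :=
    Units.ext (by rw [val_globalToLocalUnits, hz'k]; rfl)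
  set u : (v.adicCompletion K)ˣ := y⁻¹ * z' with hu
  have huU : u ∈ U := hz'C
  have hRu : R u = 1 := hR_norm _ (Subgroup.mem_inf.mp huU).1
  have hIu : I u = 0 := hI_pow u (Subgroup.mem_inf.mp huU).2
  -- conclude
  have hzyu : z' = y * u := by rw [hu, mul_inv_cancel_left]
  have hIy : I y = Multiplicative.toAdd (R y) := by
    have h := hglob b
    rw [hbz, hzyu, hImul, hIu, add_zero, map_mul, hRu, mul_one] at h
    exact h
  have hyw : canonicalArtin (v.adicCompletion K) w = y := Units.ext (by rw [hw]; rfl)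
  have hfin : I y = -ψ (absGaloisRestrict K (v.adicCompletion K)
      (WeilGroup.toAbsGalois (v.adicCompletion K) w)) := by rw [hIy, ← hyw, hR_art]
  simp only [hI] at hfin
  exact hfin

/-- **`κₙ(x) ∪ [ψ ∘ res_v] = 0 ↔ ψ(res_v w) = 0`** (`Art_v w = x`; `inv_n` is injective).
[cite: SerreLocalFields1979, XIV §1 Prop. 3 and Cor.] -/
theorem cupProduct_δ₀_eq_zero_iff_of_forall_apply
    (ψ : CyclicCharacter (absoluteGaloisGroup K) n) (hker : ψ.ker = galFixing K L)
    (c : contOneCocycles ((mu (v.adicCompletion K) n).tateDual n).toTopRep)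
    (hc : ∀ (σ : absoluteGaloisGroup (v.adicCompletion K)) (m : MuCarrier (v.adicCompletion K) n),
      c.1 σ m = (((ψ (absGaloisRestrict K (v.adicCompletion K) σ)).val : ℤ)) • m)
    (x : v.adicCompletion K) (hx : x ≠ 0) (w : WeilGroup (v.adicCompletion K))
    (hw : ((canonicalArtin (v.adicCompletion K) w : (v.adicCompletion K)ˣ) : v.adicCompletion K) = x) :
    haveI : CompactSpace (absoluteGaloisGroup (v.adicCompletion K)) := absoluteGaloisGroup_compactSpace _
    ((mu (v.adicCompletion K) n).tateDualPairing n).cupProduct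
        ((isSES_kummer (v.adicCompletion K) n (NeZero.pos n)).δ₀ (baseUnitsInvariant (v.adicCompletion K) x hx))
        (oneCocycleClass _ c) = 0 ↔
      ψ (absGaloisRestrict K (v.adicCompletion K) (WeilGroup.toAbsGalois (v.adicCompletion K) w)) = 0 := by
  haveI : CompactSpace (absoluteGaloisGroup (v.adicCompletion K)) := absoluteGaloisGroup_compactSpace _
  haveI : CharZero (v.adicCompletion K) := charZero_adicCompletion v
  let ι : continuousCohomology 2 (mu (v.adicCompletion K) n).toTopRep →+ ZMod n := invLevel (v.adicCompletion K) n
  have h : ι (((mu (v.adicCompletion K) n).tateDualPairing n).cupProduct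
      ((isSES_kummer (v.adicCompletion K) n (NeZero.pos n)).δ₀ (baseUnitsInvariant (v.adicCompletion K) x hx))
      (oneCocycleClass _ c)) =
      -ψ (absGaloisRestrict K (v.adicCompletion K) (WeilGroup.toAbsGalois (v.adicCompletion K) w)) :=
    invLevel_cupProduct_δ₀_eq_neg_apply_of_forall_apply L v ψ hker c hc x hx w hw
  constructor
  · intro h0
    rw [h0, map_zero ι] at h
    exact neg_eq_zero.mp h.symm
  · intro h0
    rw [h0, neg_zero] at h
    exact (isInvariantMap_invLevel (v.adicCompletion K) n).1.1 (h.trans (map_zero ι).symm)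

end LocalB

/-! ### §3. At `v ∣ p`, against a character factoring through `ε_p`: Kato II Lemma 1.4.5 levelwise -/

section Cyclotomic

variable {K : Type} [Field K] [NumberField K] {n : ℕ} [NeZero n]
  (L : IntermediateField K (AlgebraicClosure K)) [FiniteDimensional K L] [IsAbelianGalois K L]
  [NumberField L] (v : HeightOneSpectrum (𝓞 K)) (p : ℕ) [Fact p.Prime]

/-- **Kato II Lemma 1.4.5 levelwise at a completion `v ∣ p`, any decomposition behaviour.**  `ψ : Γ_K ↠ ℤ/n`
global cyclic (`ker ψ = Gal(K̄/L)`) factoring through the `p`-adic cyclotomic character (`ε_p σ = ε_p τ → ψ σ = ψ τ`),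
`c : Γ_{K_v} → μₙ^∨(1)` any continuous crossed homomorphism with `c(σ)(m) = ψ(res_v σ)·m`, `u ∈ 𝒪_vˣ`
(`|u|_v = 1`), `σ ∈ Γ_K` with `ε_p(σ) = N_{K_v/ℚ_p}(u)` in `ℚ_p` (canonical `ℚ_p`-structure of `K_v`).  Then
`inv_n (κₙ(u) ∪ [c]) = -ψ(σ)`: the local symbol of a unit against a cyclotomic layer character is read off its
norm (`Art_v(I) = 𝒪_vˣ`, §2, `ε_p ∘ res_v = ε_p^{K_v}` and `ε_p^{K_v}(w) = N(Art_v w)` on inertia —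
`cyclotomicCharacter_toAbsGalois_eq_norm_canonicalArtin`, Serre LCFT §3.1 Thm. 2 with §2.4).
[cite: Kato1993LNM1553, Ch. II Lemma 1.4.5] [cite: SerreLocalFields1979, XIV §1 Prop. 3]
[cite: CasselsFrohlichANT1967, Ch. VI §3.1 Thm. 2 with §2.4] -/
theorem invLevel_cupProduct_δ₀_eq_neg_apply_of_cyclotomicCharacter_eq_norm_of_forall_apply
    (hp : valuation (v.adicCompletion K) (p : v.adicCompletion K) < 1)
    (ψ : CyclicCharacter (absoluteGaloisGroup K) n) (hker : ψ.ker = galFixing K L)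
    (hψε : ∀ σ τ : absoluteGaloisGroup K,
      GaloisRep.cyclotomicCharacter K p σ = GaloisRep.cyclotomicCharacter K p τ → ψ σ = ψ τ)
    (c : contOneCocycles ((mu (v.adicCompletion K) n).tateDual n).toTopRep)
    (hc : ∀ (σ : absoluteGaloisGroup (v.adicCompletion K)) (m : MuCarrier (v.adicCompletion K) n),
      c.1 σ m = (((ψ (absGaloisRestrict K (v.adicCompletion K) σ)).val : ℤ)) • m)
    (u : v.adicCompletion K) (hu : u ≠ 0) (hu1 : valuation (v.adicCompletion K) u = 1)
    (σ : absoluteGaloisGroup K)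
    (hσ : haveI : CharZero (v.adicCompletion K) := charZero_adicCompletion v
      letI := LocalField.padicAlgebra (v.adicCompletion K) p hp
      (((GaloisRep.cyclotomicCharacter K p σ : ℤ_[p]ˣ) : ℤ_[p]) : ℚ_[p]) = Algebra.norm ℚ_[p] u) :
    haveI : CompactSpace (absoluteGaloisGroup (v.adicCompletion K)) := absoluteGaloisGroup_compactSpace _
    haveI : CharZero (v.adicCompletion K) := charZero_adicCompletion v
    invLevel (v.adicCompletion K) n (((mu (v.adicCompletion K) n).tateDualPairing n).cupProduct
        ((isSES_kummer (v.adicCompletion K) n (NeZero.pos n)).δ₀ (baseUnitsInvariant (v.adicCompletion K) u hu))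
        (oneCocycleClass _ c)) = -ψ σ := by
  haveI : CompactSpace (absoluteGaloisGroup (v.adicCompletion K)) := absoluteGaloisGroup_compactSpace _
  haveI : CharZero (v.adicCompletion K) := charZero_adicCompletion v
  haveI : NeZero (p : K) := ⟨Nat.cast_ne_zero.mpr (Fact.out : p.Prime).ne_zero⟩
  letI := LocalField.padicAlgebra (v.adicCompletion K) p hp
  -- a `w ∈ I` with `Art_v w = u` (`Art_v(I) = 𝒪_vˣ`)
  have hmem : Units.mk0 u hu ∈ (WeilGroup.inertia (v.adicCompletion K)).map (canonicalArtin (v.adicCompletion K)) := by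
    rw [(isLocalArtinMap_canonicalArtin_holds (v.adicCompletion K)).image_inertia, Valuation.mem_unitGroup_iff]
    exact hu1
  obtain ⟨w, hwI, hw⟩ := Subgroup.mem_map.mp hmem
  have hw' : ((canonicalArtin (v.adicCompletion K) w : (v.adicCompletion K)ˣ) : v.adicCompletion K) = u := by
    rw [hw]; rfl
  let ι : continuousCohomology 2 (mu (v.adicCompletion K) n).toTopRep →+ ZMod n := invLevel (v.adicCompletion K) n
  have h : ι (((mu (v.adicCompletion K) n).tateDualPairing n).cupProduct
      ((isSES_kummer (v.adicCompletion K) n (NeZero.pos n)).δ₀ (baseUnitsInvariant (v.adicCompletion K) u hu))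
      (oneCocycleClass _ c)) =
      -ψ (absGaloisRestrict K (v.adicCompletion K) (WeilGroup.toAbsGalois (v.adicCompletion K) w)) :=
    invLevel_cupProduct_δ₀_eq_neg_apply_of_forall_apply L v ψ hker c hc u hu w hw'
  -- `ε_p(res w) = ε_p(σ)`: both have image `N_{K_v/ℚ_p}(u)` in `ℚ_p`
  have hε : GaloisRep.cyclotomicCharacter K p
      (absGaloisRestrict K (v.adicCompletion K) (WeilGroup.toAbsGalois (v.adicCompletion K) w)) =
        GaloisRep.cyclotomicCharacter K p σ := by
    refine Units.ext (PadicInt.ext ?_)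
    rw [cyclotomicCharacter_absGaloisRestrict K (v.adicCompletion K) p,
      cyclotomicCharacter_toAbsGalois_eq_norm_canonicalArtin p (v.adicCompletion K) hp hwI, hw', hσ]
  change ι _ = _
  rw [h, hψε _ _ hε]

end Cyclotomic

end Literature.NumberTheory.GaloisCohomology

end
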